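import Literature.Probability.LatticeModels.PolymerGas
import HarnessLib

/-!
# The independence polynomial: Shearer's disc and the Peters–Regts zero-free region (Sokal's conjecture)

Topic `Literature/Probability/LatticeModels` — the hard-core lattice gas on a finite graph.

For a finite simple graph `G = (V, E)` the (univariate) **independence polynomial**, in statistical
mechanics the partition function of the hard-core model at activity `z`, is
`Z_G(z) = ∑_{I ⊆ V independent} z ^ #I` [PetersRegts2019, §1]; the **tree-uniqueness threshold** of
the hard-core model at maximum degree `Δ` is `λ_c(Δ) = (Δ - 1)^{Δ - 1} / (Δ - 2)^Δ` (Kelly 1985,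
Weitz 2006; written `λ_Δ` in [PetersRegts2019, §1]).

* `independencePolynomial G z` (over any commutative semiring, so that it serves real sums and
  complex evaluations alike), `hardCoreThreshold Δ : ℝ`, unfolding / cast / positivity lemmas, and
  the bridge `independencePolynomial_eq_polymerPartitionFunction` to the abstract hard-core
  polymer gas of `PolymerGas` (polymers = vertices, incompatibility = adjacency), whose
  one-vertex recursion `Z_K = Z_{K - u} + z · Z_{K - N[u]}` drives everything below.
* PROVED — **Shearer's disc** [ScottSokal2005, Cor. 5.7] (Shearer 1985): if `G` has maximum
  degree at most `Δ` then `Z_G(z) ≠ 0` for `‖z‖ ≤ (Δ - 1)^{Δ - 1} / Δ^Δ` when `Δ ≥ 3`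
  (`independencePolynomial_ne_zero_of_norm_le`) and for `‖z‖ < (Δ - 1)^{Δ - 1} / Δ^Δ` when
  `Δ ≥ 2` (`…_of_norm_lt`), by the Dobrushin–Shearer induction over vertex subsets
  (`polymerPartitionFunction_adj_ne_zero`: `‖Z_{K-u}‖ ≤ (Δ/(Δ-1)) ‖Z_K‖ whenever `u` has at most
  `Δ - 1` neighbours in `K`).
* NAMED FACT — **the Peters–Regts theorem** `PetersRegts2019_zeroFree` (Sokal's conjecture)
  [PetersRegts2019, Thm. 1.1]: for every `Δ ≥ 3` there is a complex domain `D_Δ ⊇ [0, λ_c(Δ))`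
  such that `Z_G(z) ≠ 0` for every `z ∈ D_Δ` and every graph `G` of maximum degree at most `Δ`.
  Not proved here: the printed proof pushes the ratios `R_{G,v} = z · Z_{G - N[v]} / Z_{G - v}`
  through the recursion `R = z / ∏ᵢ (1 + Rᵢ)` inside an explicitly constructed forward-invariant
  domain in logarithmic coordinates (ibid. §§3–4: Lemma 4.1, and Thm. 4.2 for the multivariate
  `ε`-version; arXiv numbering) — a self-contained but long piece of real analysis.
* PROVED consequence, in the form consumed by Barvinok-type interpolation [Barvinok2016, §2.2],
  [PatelRegts2017]: a uniform `δ`-neighbourhood of every compact piece `[0, λ₁]`, `λ₁ < λ_c(Δ)`,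
  is zero-free (`PetersRegts2019_zeroFree.exists_thickening`; compactness of the segment).

Design: `independencePolynomial` is an evaluation map `R → R`, not a `Polynomial R` (every
statement in view — zero-freeness, ratios, `log` — is about values); graphs are Mathlib
`SimpleGraph`s on a `Fintype` with Mathlib's `IsIndepSet`/`maxDegree` (loops and parallel edges do
not change `Z_G` [PetersRegts2019, §1]); the named fact quantifies over vertex types in `Type`,
`Fin n` being the intended instances. Not here: the multivariate polynomial (it *is*
`polymerPartitionFunction G.Adj`), the optimality of `λ_c(Δ)` [PetersRegts2019, Prop. 1.2], the
multivariate `ε`-version, Weitz's algorithm and the interpolation method themselves.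

## References

* H. Peters, G. Regts, *On a conjecture of Sokal concerning roots of the independence
  polynomial*, Michigan Math. J. **68** (2019) 33–55, arXiv:1701.08049 (numbers other than
  Thm. 1.1 / Prop. 1.2 follow the arXiv version): §1, Thm. 1.1, Prop. 1.2, Lemma 4.1, Thm. 4.2.
  [PetersRegts2019]
* A. D. Scott, A. D. Sokal, *The repulsive lattice gas, the independent-set polynomial, and the
  Lovász local lemma*, J. Stat. Phys. **118** (2005) 1151–1261, arXiv:cond-mat/0309352: §1
  (1.2)–(1.3), Thm. 5.1 (Dobrushin), Cor. 5.3, Thm. 5.6, Cor. 5.7 (Shearer). [ScottSokal2005]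
* A. Barvinok, *Combinatorics and Complexity of Partition Functions*, Springer 2016, §2.2.
  [Barvinok2016]
* V. Patel, G. Regts, *Deterministic polynomial-time approximation algorithms for partition
  functions and graph polynomials*, SIAM J. Comput. **46** (2017). [PatelRegts2017]
-/

open Finset

namespace Literature.Probability.LatticeModels

section IndependencePolynomial

variable {V : Type*} [Fintype V] [DecidableEq V] (G : SimpleGraph V) [DecidableRel G.Adj]

/-- The **independence polynomial** (partition function of the hard-core model) of the finite
simple graph `G`, evaluated at the activity `z`:
`Z_G(z) = ∑_{I ⊆ V, I independent} z ^ #I`; at `z = 1` it counts the independent sets of `G`.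
[cite: PetersRegts2019, §1] -/
def independencePolynomial {R : Type*} [CommSemiring R] (z : R) : R :=
  ∑ I : Finset V, if G.IsIndepSet (I : Set V) then z ^ I.card else 0

/-- `Z_G(0) = 1`: only the empty independent set survives. [folklore] -/
@[simp] theorem independencePolynomial_zero {R : Type*} [CommSemiring R] :
    independencePolynomial G (0 : R) = 1 := by
  rw [independencePolynomial, sum_eq_single (∅ : Finset V)]
  · rw [if_pos (by simp [SimpleGraph.isIndepSet_iff]), card_empty, pow_zero]
  · intro I _ hI
    rw [zero_pow (card_ne_zero.2 (nonempty_iff_ne_empty.2 hI)), ite_self]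
  · exact fun h => (h (mem_univ _)).elim

/-- Ring homomorphisms commute with `Z_G`: `f (Z_G(z)) = Z_G(f z)`. [folklore] -/
theorem map_independencePolynomial {R S : Type*} [CommSemiring R] [CommSemiring S]
    (f : R →+* S) (z : R) :
    f (independencePolynomial G z) = independencePolynomial G (f z) := by
  simp only [independencePolynomial, map_sum, apply_ite f, map_pow, map_zero]

/-- The real independence polynomial cast to `ℂ` is the complex one. [folklore] -/
@[simp, norm_cast] theorem ofReal_independencePolynomial (t : ℝ) :
    ((independencePolynomial G t : ℝ) : ℂ) = independencePolynomial G (t : ℂ) :=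
  map_independencePolynomial G Complex.ofRealHom t

/-- For real `t ≥ 0`, `1 ≤ Z_G(t)` (the empty set contributes `1`, every other independent set a
non-negative amount); in particular `Z_G` has no zeros on `[0, ∞)`. [folklore] -/
theorem one_le_independencePolynomial {t : ℝ} (ht : 0 ≤ t) : 1 ≤ independencePolynomial G t := by
  have h0 : (if G.IsIndepSet ((∅ : Finset V) : Set V) then t ^ (∅ : Finset V).card else 0) = 1 := by
    rw [if_pos (by simp [SimpleGraph.isIndepSet_iff]), card_empty, pow_zero]
  calc (1 : ℝ) = _ := h0.symm
    _ ≤ independencePolynomial G t :=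
      single_le_sum (s := univ)
        (f := fun I : Finset V => if G.IsIndepSet (I : Set V) then t ^ I.card else 0)
        (fun I _ => by positivity) (mem_univ ∅)

/-- For real `t ≥ 0`, `0 < Z_G(t)`. [folklore] -/
theorem independencePolynomial_pos {t : ℝ} (ht : 0 ≤ t) : 0 < independencePolynomial G t :=
  one_pos.trans_le (one_le_independencePolynomial G ht)

/-- **Bridge to the abstract polymer gas.** The independence polynomial of `G` at `z` is the
partition function of the hard-core polymer gas whose polymers are the vertices, incompatibility
is adjacency and every activity is `z` (`PolymerGas.polymerPartitionFunction`, Fernández–Procacci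
eq. (2)), over the whole vertex set. [cite: ScottSokal2005, §1 (1.2)–(1.3)] -/
theorem independencePolynomial_eq_polymerPartitionFunction (z : ℂ) :
    independencePolynomial G z = polymerPartitionFunction G.Adj (fun _ => z) univ := by
  rw [independencePolynomial, polymerPartitionFunction, powerset_univ]
  refine sum_congr rfl fun A _ => ?_
  rw [prod_const]
  exact if_congr Iff.rfl rfl rfl

/-! ### Shearer's disc (the Dobrushin–Shearer induction) -/

variable {G}

/-- **The Dobrushin–Shearer induction** for the hard-core gas on a graph of maximum degree at most
`Δ ≥ 2`, run on the restrictions `Z_K := Ξ_K` of the partition function to vertex subsets `K`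
(Scott–Sokal 2005, proof of Cor. 5.7 via Thm. 5.6; Shearer 1985). If `a ≥ 1`,
`‖z‖ · a ^ (Δ - 1) ≤ 1 - a⁻¹` and `‖z‖ · a ^ Δ < 1`, then every `Z_K ≠ 0`; the induction carries
along `‖Z_{K - u}‖ ≤ a · ‖Z_K‖` for every `u ∈ K` with at most `Δ - 1` neighbours in `K`, via the
one-vertex recursion `Z_K = Z_{K-u} + z · Z_{K - N[u]}` and the telescoping
`‖Z_{K - N[u]}‖ ≤ a ^ {deg_K u} · ‖Z_{K-u}‖` (each removed neighbour of `u` has lost the neighbour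
`u`, hence has at most `Δ - 1` neighbours left). The intended value is `a = Δ / (Δ - 1)`.
[cite: ScottSokal2005, Cor. 5.7 (proof)] -/
theorem polymerPartitionFunction_adj_ne_zero {Δ : ℕ} (hG : G.maxDegree ≤ Δ) {a : ℝ} (ha : 1 ≤ a)
    {z : ℂ} (h₁ : ‖z‖ * a ^ (Δ - 1) ≤ 1 - a⁻¹) (h₂ : ‖z‖ * a ^ Δ < 1) (K : Finset V) :
    polymerPartitionFunction G.Adj (fun _ => z) K ≠ 0 := by
  set Z : Finset V → ℂ := fun K => polymerPartitionFunction G.Adj (fun _ => z) K with hZ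
  have hsymm : ∀ u v : V, G.Adj u v → G.Adj v u := fun _ _ h => h.symm
  have ha0 : 0 < a := one_pos.trans_le ha
  -- degree bookkeeping: the neighbours of `u` inside any `B` number at most `Δ`, and at most
  -- `Δ - 1` if some neighbour `w` of `u` lies outside `B`
  have hdeg : ∀ (u : V) (B : Finset V), (B.filter (G.Adj u)).card ≤ Δ := fun u B =>
    calc (B.filter (G.Adj u)).card ≤ (G.neighborFinset u).card :=
          card_le_card fun m hm => (G.mem_neighborFinset u m).2 (mem_filter.1 hm).2
      _ ≤ Δ := (G.degree_le_maxDegree u).trans hG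
  have hdeg' : ∀ (u w : V) (B : Finset V), G.Adj u w → w ∉ B →
      (B.filter (G.Adj u)).card ≤ Δ - 1 := by
    intro u w B huw hwB
    have hsub : B.filter (G.Adj u) ⊆ (G.neighborFinset u).erase w := fun m hm =>
      mem_erase.2 ⟨fun h => hwB (h ▸ (mem_filter.1 hm).1),
        (G.mem_neighborFinset u m).2 (mem_filter.1 hm).2⟩
    calc (B.filter (G.Adj u)).card ≤ ((G.neighborFinset u).erase w).card := card_le_card hsub
      _ = G.degree u - 1 := by
          rw [card_erase_of_mem ((G.mem_neighborFinset u w).2 huw), G.card_neighborFinset_eq_degree]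
      _ ≤ Δ - 1 := Nat.sub_le_sub_right ((G.degree_le_maxDegree u).trans hG) 1
  -- the joint induction
  suffices main : ∀ K : Finset V, Z K ≠ 0 ∧
      ∀ u ∈ K, ((K.erase u).filter (G.Adj u)).card ≤ Δ - 1 → ‖Z (K.erase u)‖ ≤ a * ‖Z K‖ from
    (main K).1
  intro K
  induction K using Finset.strongInduction with
  | H K ih =>
    -- telescoping: remove, one at a time, a set `M` of neighbours of a vertex `w ∉ B`, `B ⊂ K`
    have tele : ∀ (w : V) (B : Finset V), B ⊂ K → w ∉ B → ∀ M : Finset V,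
        (∀ m ∈ M, G.Adj w m) → ‖Z (B \ M)‖ ≤ a ^ M.card * ‖Z B‖ := by
      intro w B hB hwB M
      induction M using Finset.induction_on with
      | empty => intro; simp
      | @insert m M hm ihM =>
        intro hM
        have hBM : B \ M ⊂ K := lt_of_le_of_lt sdiff_le hB
        have ih' := ihM fun m' hm' => hM m' (mem_insert_of_mem hm')
        rw [sdiff_insert, card_insert_of_notMem hm, pow_succ']
        by_cases hmB : m ∈ B \ M
        · have hwBM : w ∉ B \ M := fun h => hwB (mem_sdiff.1 h).1
          have hd : (((B \ M).erase m).filter (G.Adj m)).card ≤ Δ - 1 :=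
            hdeg' m w _ (hsymm _ _ (hM m (mem_insert_self m M))) (fun h => hwBM (mem_erase.1 h).2)
          calc ‖Z ((B \ M).erase m)‖ ≤ a * ‖Z (B \ M)‖ := (ih _ hBM).2 m hmB hd
            _ ≤ a * (a ^ M.card * ‖Z B‖) := mul_le_mul_of_nonneg_left ih' ha0.le
            _ = a * a ^ M.card * ‖Z B‖ := by ring
        · rw [erase_eq_of_notMem hmB]
          calc ‖Z (B \ M)‖ ≤ a ^ M.card * ‖Z B‖ := ih'
            _ = 1 * (a ^ M.card * ‖Z B‖) := (one_mul _).symm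
            _ ≤ a * (a ^ M.card * ‖Z B‖) := mul_le_mul_of_nonneg_right ha (by positivity)
            _ = a * a ^ M.card * ‖Z B‖ := by ring
    -- the one-vertex step at `u ∈ K`: `Z K = Z B + z * Z (B \ M)` with `B = K - u`,
    -- `M` = the neighbours of `u` in `B`, and `‖Z (B \ M)‖ ≤ a ^ #M * ‖Z B‖`
    have step : ∀ u ∈ K, Z (K.erase u) ≠ 0 ∧
        ‖Z (K.erase u)‖ - ‖z‖ * (a ^ ((K.erase u).filter (G.Adj u)).card * ‖Z (K.erase u)‖) ≤
          ‖Z K‖ := by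
      intro u hu
      set B := K.erase u with hB
      set M := B.filter (G.Adj u) with hM
      have hBK : B ⊂ K := erase_ssubset hu
      have huB : u ∉ B := notMem_erase u K
      refine ⟨(ih B hBK).1, ?_⟩
      have hrec : Z K = Z B + z * Z (B \ M) := by
        have h := polymerPartitionFunction_eq_erase_add (inc := G.Adj) hsymm (fun _ => z) hu
        rw [hM, ← filter_not]
        exact h
      have htele : ‖Z (B \ M)‖ ≤ a ^ M.card * ‖Z B‖ :=
        tele u B hBK huB M fun m hm => (mem_filter.1 hm).2
      calc ‖Z B‖ - ‖z‖ * (a ^ M.card * ‖Z B‖)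
          ≤ ‖Z B‖ - ‖z * Z (B \ M)‖ := by
            rw [norm_mul]
            exact sub_le_sub_left (mul_le_mul_of_nonneg_left htele (norm_nonneg _)) _
        _ ≤ ‖Z B + z * Z (B \ M)‖ := by
            simpa [sub_neg_eq_add, norm_neg] using norm_sub_norm_le (Z B) (-(z * Z (B \ M)))
        _ = ‖Z K‖ := by rw [hrec]
    refine ⟨?_, ?_⟩
    · -- `Z K ≠ 0`
      rcases K.eq_empty_or_nonempty with rfl | ⟨u, hu⟩
      · simp [hZ]
      · obtain ⟨hB0, hle⟩ := step u hu
        have hcard : ((K.erase u).filter (G.Adj u)).card ≤ Δ := hdeg u _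
        have hpow : a ^ ((K.erase u).filter (G.Adj u)).card ≤ a ^ Δ := pow_le_pow_right₀ ha hcard
        have hpos : 0 < ‖Z (K.erase u)‖ := norm_pos_iff.2 hB0
        have key : 0 < ‖Z (K.erase u)‖ - ‖z‖ * (a ^ ((K.erase u).filter (G.Adj u)).card *
            ‖Z (K.erase u)‖) := by
          have h1 : ‖z‖ * (a ^ ((K.erase u).filter (G.Adj u)).card * ‖Z (K.erase u)‖) ≤
              ‖z‖ * a ^ Δ * ‖Z (K.erase u)‖ := by
            rw [mul_assoc]
            exact mul_le_mul_of_nonneg_left (mul_le_mul_of_nonneg_right hpow hpos.le)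
              (norm_nonneg _)
          nlinarith [mul_lt_mul_of_pos_right h₂ hpos]
        exact norm_pos_iff.1 (key.trans_le hle)
    · -- the ratio bound at a vertex with at most `Δ - 1` neighbours in `K`
      intro u hu hd
      obtain ⟨hB0, hle⟩ := step u hu
      have hpow : a ^ ((K.erase u).filter (G.Adj u)).card ≤ a ^ (Δ - 1) := pow_le_pow_right₀ ha hd
      have hpos : 0 < ‖Z (K.erase u)‖ := norm_pos_iff.2 hB0
      have h1 : ‖z‖ * (a ^ ((K.erase u).filter (G.Adj u)).card * ‖Z (K.erase u)‖) ≤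
          (1 - a⁻¹) * ‖Z (K.erase u)‖ := by
        rw [← mul_assoc]
        exact mul_le_mul_of_nonneg_right
          ((mul_le_mul_of_nonneg_left hpow (norm_nonneg _)).trans h₁) hpos.le
      have h2 : a⁻¹ * ‖Z (K.erase u)‖ ≤ ‖Z K‖ := by nlinarith
      calc ‖Z (K.erase u)‖ = a * (a⁻¹ * ‖Z (K.erase u)‖) := by field_simp
        _ ≤ a * ‖Z K‖ := mul_le_mul_of_nonneg_left h2 ha0.le

/-- Shearer's disc at maximum degree `k + 2`, both forms at once: `‖z‖ ≤ (k+1)^{k+1}/(k+2)^{k+2}`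
together with the strict top-level condition `‖z‖ · ((k+2)/(k+1))^{k+2} < 1` forces `Z_G(z) ≠ 0`
(the induction `polymerPartitionFunction_adj_ne_zero` with `a = (k+2)/(k+1) = Δ/(Δ-1)`).
[cite: ScottSokal2005, Cor. 5.7 (proof)] -/
theorem independencePolynomial_ne_zero_of_norm_le_aux {k : ℕ} (hG : G.maxDegree ≤ k + 2) {z : ℂ}
    (hz : ‖z‖ ≤ ((k : ℝ) + 1) ^ (k + 1) / ((k : ℝ) + 2) ^ (k + 2))
    (h₂ : ‖z‖ * (((k : ℝ) + 2) / ((k : ℝ) + 1)) ^ (k + 2) < 1) :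
    independencePolynomial G z ≠ 0 := by
  have hk : (0 : ℝ) ≤ k := k.cast_nonneg
  rw [independencePolynomial_eq_polymerPartitionFunction]
  refine polymerPartitionFunction_adj_ne_zero hG (a := ((k : ℝ) + 2) / ((k : ℝ) + 1))
    (by rw [le_div_iff₀ (by positivity)]; linarith) ?_ h₂ univ
  have h : ((k : ℝ) + 1) ^ (k + 1) / ((k : ℝ) + 2) ^ (k + 2) *
      (((k : ℝ) + 2) / ((k : ℝ) + 1)) ^ (k + 1) = 1 - (((k : ℝ) + 2) / ((k : ℝ) + 1))⁻¹ := by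
    rw [div_pow]
    field_simp
    ring
  calc ‖z‖ * (((k : ℝ) + 2) / ((k : ℝ) + 1)) ^ (k + 2 - 1)
      ≤ ((k : ℝ) + 1) ^ (k + 1) / ((k : ℝ) + 2) ^ (k + 2) *
          (((k : ℝ) + 2) / ((k : ℝ) + 1)) ^ (k + 1) :=
        mul_le_mul_of_nonneg_right hz (by positivity)
    _ = _ := h

/-- The value of `‖z‖ · a^{Δ}` on the boundary of Shearer's disc, `a = Δ/(Δ-1)`, `Δ = k + 2`:
`r · a^{k+2} = 1/(k+1)` for `r = (k+1)^{k+1}/(k+2)^{k+2}`. [folklore] -/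
theorem shearerRadius_mul_pow (k : ℕ) :
    ((k : ℝ) + 1) ^ (k + 1) / ((k : ℝ) + 2) ^ (k + 2) * (((k : ℝ) + 2) / ((k : ℝ) + 1)) ^ (k + 2) =
      1 / ((k : ℝ) + 1) := by
  have hk : (0 : ℝ) ≤ k := k.cast_nonneg
  rw [div_pow]
  field_simp
  ring

/-- **Shearer's disc, closed form, `Δ ≥ 3`** (Shearer 1985; Scott–Sokal 2005, Cor. 5.7, which is
printed for `Δ ≥ 2`, the closed polydisc, and even one vertex of larger radius `(Δ-1)^Δ/Δ^Δ`; this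
is its univariate case for `Δ ≥ 3`): if `G` has maximum degree at most `Δ` and
`‖z‖ ≤ (Δ - 1)^{Δ - 1} / Δ^Δ` then `Z_G(z) ≠ 0`. The radius is optimal (complete `(Δ-1)`-ary
trees). [cite: ScottSokal2005, Cor. 5.7] -/
theorem independencePolynomial_ne_zero_of_norm_le {Δ : ℕ} (hΔ : 3 ≤ Δ) (hG : G.maxDegree ≤ Δ)
    {z : ℂ} (hz : ‖z‖ ≤ ((Δ : ℝ) - 1) ^ (Δ - 1) / (Δ : ℝ) ^ Δ) :
    independencePolynomial G z ≠ 0 := by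
  obtain ⟨k, rfl⟩ : ∃ k, Δ = k + 2 := ⟨Δ - 2, by omega⟩
  have hk : (1 : ℝ) ≤ k := by exact_mod_cast (show 1 ≤ k by omega)
  rw [show k + 2 - 1 = k + 1 from rfl] at hz
  push_cast at hz
  rw [show (k : ℝ) + 2 - 1 = (k : ℝ) + 1 by ring] at hz
  refine independencePolynomial_ne_zero_of_norm_le_aux hG hz ?_
  calc ‖z‖ * (((k : ℝ) + 2) / ((k : ℝ) + 1)) ^ (k + 2)
      ≤ ((k : ℝ) + 1) ^ (k + 1) / ((k : ℝ) + 2) ^ (k + 2) *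
          (((k : ℝ) + 2) / ((k : ℝ) + 1)) ^ (k + 2) :=
        mul_le_mul_of_nonneg_right hz (by positivity)
    _ = 1 / ((k : ℝ) + 1) := shearerRadius_mul_pow k
    _ < 1 := by rw [div_lt_one (by positivity)]; linarith

/-- **Shearer's disc, open form, `Δ ≥ 2`**: if `G` has maximum degree at most `Δ ≥ 2` and
`‖z‖ < (Δ - 1)^{Δ - 1} / Δ^Δ` then `Z_G(z) ≠ 0` (for `Δ = 2` the closed disc of Scott–Sokal
Cor. 5.7 needs the finer connected-component bookkeeping of their Thm. 5.6, not done here).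
[cite: ScottSokal2005, Cor. 5.7] -/
theorem independencePolynomial_ne_zero_of_norm_lt {Δ : ℕ} (hΔ : 2 ≤ Δ) (hG : G.maxDegree ≤ Δ)
    {z : ℂ} (hz : ‖z‖ < ((Δ : ℝ) - 1) ^ (Δ - 1) / (Δ : ℝ) ^ Δ) :
    independencePolynomial G z ≠ 0 := by
  obtain ⟨k, rfl⟩ : ∃ k, Δ = k + 2 := ⟨Δ - 2, by omega⟩
  have hk : (0 : ℝ) ≤ k := k.cast_nonneg
  rw [show k + 2 - 1 = k + 1 from rfl] at hz
  push_cast at hz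
  rw [show (k : ℝ) + 2 - 1 = (k : ℝ) + 1 by ring] at hz
  refine independencePolynomial_ne_zero_of_norm_le_aux hG hz.le ?_
  calc ‖z‖ * (((k : ℝ) + 2) / ((k : ℝ) + 1)) ^ (k + 2)
      < ((k : ℝ) + 1) ^ (k + 1) / ((k : ℝ) + 2) ^ (k + 2) *
          (((k : ℝ) + 2) / ((k : ℝ) + 1)) ^ (k + 2) :=
        mul_lt_mul_of_pos_right hz (by positivity)
    _ = 1 / ((k : ℝ) + 1) := shearerRadius_mul_pow k
    _ ≤ 1 := by rw [div_le_one (by positivity)]; linarith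

end IndependencePolynomial

/-! ### The tree-uniqueness threshold and the Peters–Regts theorem -/

/-- The **tree-uniqueness threshold** of the hard-core model at maximum degree `Δ`,
`λ_c(Δ) = (Δ - 1)^{Δ - 1} / (Δ - 2)^Δ` (the critical activity of the hard-core model on the
infinite `Δ`-regular tree: Kelly 1985, Weitz 2006; `λ_Δ` in Peters–Regts). Meaningful for
`Δ ≥ 3` (`λ_c(3) = 4`); at `Δ = 2` the printed value is `+∞` and this definition returns the junk
value `1 / 0 = 0`, at `Δ ≤ 1` other junk values (truncated subtraction). Written exactly as in the
route statements that consume it. [cite: PetersRegts2019, §1] -/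
noncomputable def hardCoreThreshold (Δ : ℕ) : ℝ := ((Δ : ℝ) - 1) ^ (Δ - 1) / ((Δ : ℝ) - 2) ^ Δ

/-- Unfolding `hardCoreThreshold`. [cite: PetersRegts2019, §1] -/
theorem hardCoreThreshold_def (Δ : ℕ) :
    hardCoreThreshold Δ = ((Δ : ℝ) - 1) ^ (Δ - 1) / ((Δ : ℝ) - 2) ^ Δ :=
  rfl

/-- `λ_c(3) = 4`. [folklore] -/
theorem hardCoreThreshold_three : hardCoreThreshold 3 = 4 := by
  norm_num [hardCoreThreshold]

/-- `λ_c(Δ) > 0` for `Δ ≥ 3`. [folklore] -/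
theorem hardCoreThreshold_pos {Δ : ℕ} (hΔ : 3 ≤ Δ) : 0 < hardCoreThreshold Δ := by
  have h3 : (3 : ℝ) ≤ Δ := by exact_mod_cast hΔ
  unfold hardCoreThreshold
  exact div_pos (pow_pos (by linarith) _) (pow_pos (by linarith) _)

/-- Shearer's radius lies strictly below the tree threshold:
`(Δ - 1)^{Δ - 1} / Δ^Δ < λ_c(Δ)` for `Δ ≥ 3` (so the Peters–Regts region genuinely extends the
disc along the positive axis). [folklore] -/
theorem shearerRadius_lt_hardCoreThreshold {Δ : ℕ} (hΔ : 3 ≤ Δ) :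
    ((Δ : ℝ) - 1) ^ (Δ - 1) / (Δ : ℝ) ^ Δ < hardCoreThreshold Δ := by
  have h3 : (3 : ℝ) ≤ Δ := by exact_mod_cast hΔ
  have hΔ0 : Δ ≠ 0 := by omega
  unfold hardCoreThreshold
  refine div_lt_div_of_pos_left (pow_pos (by linarith) _) (pow_pos (by linarith) _) ?_
  exact pow_lt_pow_left₀ (by linarith) (by linarith) hΔ0

/-- **The Peters–Regts theorem (Sokal's conjecture; named fact).** For every `Δ ≥ 3` there is a
complex domain (open connected set) `D_Δ ⊆ ℂ` containing the real interval `[0, λ_c(Δ))`,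
`λ_c(Δ) = (Δ - 1)^{Δ - 1} / (Δ - 2)^Δ`, such that for every finite graph `G` of maximum degree at
most `Δ` and every `z ∈ D_Δ`, `Z_G(z) ≠ 0`. (As printed; graphs are taken simple, which loses
nothing, ibid. §1 Preliminaries; vertex types range over `Type`, use `Fin n`.) The proof, ibid.
§§3–4, is not formalised: named fact, consumed as a hypothesis `(h : PetersRegts2019_zeroFree)`.
The interval is sharp (ibid. Prop. 1.2) and the literal multivariate analogue is false (ibid.,
Appendix), the multivariate version with `ε`-room being ibid. Thm. 4.2 (arXiv numbering).
[cite: PetersRegts2019, Thm. 1.1] -/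
def PetersRegts2019_zeroFree : Prop :=
  ∀ Δ : ℕ, 3 ≤ Δ → ∃ D : Set ℂ, IsOpen D ∧ IsConnected D ∧
    (∀ t : ℝ, 0 ≤ t → t < hardCoreThreshold Δ → (t : ℂ) ∈ D) ∧
    ∀ (V : Type) [Fintype V] [DecidableEq V] (G : SimpleGraph V) [DecidableRel G.Adj],
      G.maxDegree ≤ Δ → ∀ z ∈ D, independencePolynomial G z ≠ 0

/-- **Uniform zero-free neighbourhoods of compact pieces of `[0, λ_c)`** (the form used by the
interpolation method, Barvinok 2016 §2.2 / Patel–Regts 2017, and the shape of Peters–Regts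
Thm. 4.2 with `ε`-room): from the Peters–Regts theorem, for `Δ ≥ 3` and `0 ≤ λ₁ < λ_c(Δ)` there is
`δ > 0` such that `Z_G(z) ≠ 0` whenever `G` has maximum degree at most `Δ` and `z` is within `δ`
of some point of the segment `[0, λ₁]`. (Compactness of the segment inside the open set `D_Δ`:
`IsCompact.exists_thickening_subset_open`.) [cite: PetersRegts2019, Thm. 1.1] -/
theorem PetersRegts2019_zeroFree.exists_thickening (h : PetersRegts2019_zeroFree) {Δ : ℕ}
    (hΔ : 3 ≤ Δ) {t₁ : ℝ} (ht₁ : t₁ < hardCoreThreshold Δ) :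
    ∃ δ : ℝ, 0 < δ ∧
      ∀ (V : Type) [Fintype V] [DecidableEq V] (G : SimpleGraph V) [DecidableRel G.Adj],
        G.maxDegree ≤ Δ → ∀ (z : ℂ) (t : ℝ), 0 ≤ t → t ≤ t₁ → dist z (t : ℂ) < δ →
          independencePolynomial G z ≠ 0 := by
  obtain ⟨D, hDo, -, hDI, hDZ⟩ := h Δ hΔ
  set S : Set ℂ := ((↑) : ℝ → ℂ) '' Set.Icc 0 t₁ with hS
  have hSc : IsCompact S := isCompact_Icc.image Complex.continuous_ofReal
  have hSD : S ⊆ D := by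
    rintro _ ⟨t, ⟨ht0, ht⟩, rfl⟩
    exact hDI t ht0 (ht.trans_lt ht₁)
  obtain ⟨δ, hδ, hsub⟩ := hSc.exists_thickening_subset_open hDo hSD
  refine ⟨δ, hδ, fun V _ _ G _ hG z t ht0 ht hdist => hDZ V G hG z (hsub ?_)⟩
  exact Metric.mem_thickening_iff.2 ⟨(t : ℂ), ⟨t, ⟨ht0, ht⟩, rfl⟩, hdist⟩

/-- The Peters–Regts theorem over `Fin n` with threshold and sum written out (the shape of the
route statements that consume it). [cite: PetersRegts2019, Thm. 1.1] -/
theorem PetersRegts2019_zeroFree.fin (h : PetersRegts2019_zeroFree) {Δ : ℕ} (hΔ : 3 ≤ Δ) :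
    ∃ D : Set ℂ, IsOpen D ∧
      (∀ t : ℝ, 0 ≤ t → t < ((Δ : ℝ) - 1) ^ (Δ - 1) / ((Δ : ℝ) - 2) ^ Δ → (t : ℂ) ∈ D) ∧
      ∀ (n : ℕ) (G : SimpleGraph (Fin n)) [DecidableRel G.Adj], G.maxDegree ≤ Δ → ∀ z ∈ D,
        (∑ I : Finset (Fin n), if G.IsIndepSet (I : Set (Fin n)) then z ^ I.card else 0) ≠ 0 := by
  obtain ⟨D, hDo, -, hDI, hDZ⟩ := h Δ hΔ
  exact ⟨D, hDo, hDI, fun n G _ hG z hz => hDZ (Fin n) G hG z hz⟩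

end Literature.Probability.LatticeModels
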